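/-
Copyright: the b2b-balaban T⁴-continuum CRUX team, row NE7b leaf lineage `t4-ne7b-formalise-leaf-01` (gen 85). Project licence.
-/
import Mathlib.Analysis.InnerProductSpace.PiL2
import Mathlib.Topology.Algebra.Module.FiniteDimension
import Summits.QuantumFields.BalabanUV.T4Continuum.Spine.NE7b.TwoScalePoincareBlocking
import Summits.QuantumFields.BalabanUV.T4Continuum.Spine.NE7b.TransportedFormCoercivity

/-!
# THE LATTICE TWO-SCALE LETTERS IN THE HARD-STEP CHAIN's OWN CURRENCY, BY NAME: on `E = EuclideanSpace ℝ σ` the block average `D`, the coarse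
# block average `D⁺` and the block-constant section `S` as continuous linear maps (carried by characterising hypotheses, inhabited), the
# letters `‖D v‖ ≤ N_min^{−1∕2}‖v‖`, `‖S k‖ ≤ N_max^{1∕2}‖k‖`, `D (S k) = k`, `D⁺(D v) = 0 ↔` zero `L²`-block sums (TSPB), and THE JUNCTION
# `…TransportedFormCoercivity.kerCoercive_bilinearComp_div` BY NAME: a form `Q` with the two-scale Poincaré letter on zero composite-block sums is
# `(m₂·N)`-coercive on `ker D⁺` after transport through `S` (row NE7b, node U5c; [folklore] plumbing over TSPB + TFC)

Cell `pub-balaban`, sub-cell `t4`, spine estimate NE7b (`T4WeightBudget.RelWeightBound`; the cell's OWN estimate — NOT PRINTED in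
[Bałaban 1983–89], NOT PROVED).  Crux-route work under `Spine/NE7b/` by a row leaf (`t4-ne7b-formalise-leaf-01` gen 85) under FREEZE (0)'s
crux-prover clause; NOTHING of Bałaban's is named as a Lean object, valued or asserted; no `T4Continuum/Support` leaf typed; no `def` — the
three operators are CARRIED BY CHARACTERISING HYPOTHESES (`hD : ∀ v y, D v y = (Σ_{fibre y} v)∕#fibre y`, `hS : ∀ k x, S k x = k (blk x)`, `hDn`)
and INHABITED (`exists_blockAverageCLM`, `exists_blockConstantCLM`); zero `sorry`.  Imports: this lineage's `…TwoScalePoincareBlocking` (TSPB) and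
leaf-03's `…TransportedFormCoercivity` (TFC), plus Mathlib's `PiL2`.

WHY.  TSPB valued HSTB's two model letters for the free lattice field in the unweighted SUM currency and met TFC ∕ HSTT ∕ HSTB «BY SHAPE».  The
hard-step chain (AHE → … → HSTT, HKB → … → HKIS, TFC) is written over a real inner-product space `E` with continuous linear maps; THIS FILE
moves the lattice letters into that currency on `E = EuclideanSpace ℝ σ` (`‖v‖² = Σ_x v_x²`, so the sum currency IS the norm currency) and
feeds TFC's `kerCoercive_bilinearComp_div` BY NAME: with `D` the block average (`‖D v‖ ≤ N_min^{−1∕2}‖v‖` — `d_T`), `S` the block-constant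
section (`D ∘ S = 1`, `‖S k‖ ≤ N_max^{1∕2}‖k‖` — `μ`), `D⁺` the coarse block average and any form `Q : E →L E →L ℝ` whose two-scale letter holds
on zero composite-block sums (TSPB `twoScale_of_blockPoincare` ∕ `…CubePoincareTensorised` supply `m₂ = (L²(L²−1))⁻¹` for the Dirichlet form),
every `k ∈ ker D⁺` has `(m₂·N)·‖k‖² ≤ Q (S k) (S k)` (equal fibres `N = L^d`, `d_T² = N⁻¹`): the next kernel coercivity `m₂∕d_T²` of HSTT's
`twoSteps_of_twoScale` ∕ HKIS's `nextKerCoercive_of_twoScale`, BY VALUE AND BY NAME for the model.  It also values, in this currency, the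
located remark PS-1 of `t4-ne7b-idea-1` g102 (journal l.59923): `‖S k‖ = N^{1∕2}‖k‖` EXACTLY for equal fibres, so with the canonical
`t² = L²∕L^d` one has `t²·‖S‖² = L²` — the product `|t|·‖M‖ = L ≥ 2` that makes HSTB's `s < 1` unsatisfiable in the `ℓ²` currency
(`embed_rescale_sq`); the sup-norm currency (`‖S‖_∞ = 1`) is where print's pointwise small-field conditions live — NOT HERE.

WHAT IS PROVED ([folklore]):
* §1 `norm_sq_eq_sum_sq` (`‖v‖² = Σ_x (v x)²` on `EuclideanSpace ℝ σ`), `exists_blockAverageCLM`, `exists_blockConstantCLM` (the operators exist as CLMs).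
* §2 letters under the characterising hypotheses: `blockAverage_blockConstant` (`D (S k) = k`, fibres inhabited), **`norm_blockAverage_le`**
  (`‖D v‖ ≤ (N_min)^{−1∕2}·‖v‖` — TFC's `hd`, from TSPB `blockAverage_normSq_le`), **`norm_blockConstant_le`** (`‖S k‖ ≤ N_max^{1∕2}‖k‖` — HSTT's
  `‖M₂‖ ≤ μ`), `norm_blockConstant_eq` (equal fibres: `‖S k‖ = N^{1∕2}‖k‖`), `embed_rescale_sq` (`(L²∕L^d)·(‖S k‖²∕‖k‖²) = L²` in the form
  `(L²∕L^d)·‖S k‖² = L²‖k‖²` for `N = L^d` — PS-1 valued), `comp_eq_zero_iff_compositeBlockSums` (`D⁺ (D v) = 0 ↔` zero `L²`-block sums, TSPB BY NAME).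
* §3 **`kerCoercive_next_of_twoScalePoincare`** — THE JUNCTION BY NAME: equal fibres `N ≥ 1`, `Q : E →L E →L ℝ` with
  `∀ v, (∀ z, Σ_{x : blk₂(blk x) = z} v x = 0) → m₂·‖v‖² ≤ Q v v` (`0 ≤ m₂`) ⊢ `∀ k, D⁺ k = 0 → (m₂·N)·‖k‖² ≤ (Q.bilinearComp S S) k k`
  (TFC `kerCoercive_bilinearComp_div` with `d := N^{−1∕2}`, `m₂∕d² = m₂·N`).
* §4 toy: two fibres of two sites on `Fin 4 → Fin 2`, the block average CLM evaluated.

NOT HERE (honest): the Dirichlet form as a CLM `Q` (any symmetric matrix gives one via `innerSL`; the two-scale letter for it is TSPB §1–§2 ∕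
CPT in sum currency — the hypothesis shape of §3); the sup-norm currency; the amplitude rescaling as an operator; which blocking ∕ form ∕ currency
print has ((A3) ∕ (A1c), NC-NE7b-α UNRULED).  BY-NAME EFFECT ON THE WALL: NONE.  NE7b NOT PRINTED ∕ NOT PROVED; spine PROVED 0∕9; rung (B)+1 on
a FINITE torus — NOT infinite volume, NOT the mass gap, NOT Clay.  HONEST DEPENDENCY: continuum YM on T⁴ ⇐ BetaPertH ∧ nine spine estimates
(0∕9 proved); BetaPertH ⇐ (D1) ∧ (D4) ∧ CAP+tail; G-an2-4 gates asym, D1 and NE2∕3∕4.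
-/

set_option autoImplicit false

open Finset

namespace Summit.QuantumFields.BalabanUV.T4Continuum.NE7b.TwoScalePoincareTransported

open Summit.QuantumFields.BalabanUV.T4Continuum.NE7b.TwoScalePoincareBlocking
  (blockAverage_normSq_le blockConstant_normSq_eq blockConstant_normSq_le ker_comp_iff_compositeBlockSums)
open Summit.QuantumFields.BalabanUV.T4Continuum.NE7b.TransportedFormCoercivity (kerCoercive_bilinearComp_div)

variable {σ β γ : Type*} [Fintype σ] [Fintype β] [DecidableEq β] [Fintype γ] [DecidableEq γ]

/-! ## §1. The currency and the operators -/

/-- On `EuclideanSpace ℝ σ` the norm currency IS the sum currency: `‖v‖² = Σ_x (v x)²`. [folklore] -/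
theorem norm_sq_eq_sum_sq (v : EuclideanSpace ℝ σ) : ‖v‖ ^ 2 = ∑ x, v x ^ 2 := by
  rw [EuclideanSpace.norm_eq, Real.sq_sqrt (sum_nonneg fun _ _ => sq_nonneg _)]
  exact sum_congr rfl fun x _ => by rw [Real.norm_eq_abs, sq_abs]

/-- THE BLOCK AVERAGE EXISTS AS A CONTINUOUS LINEAR MAP `EuclideanSpace ℝ σ →L EuclideanSpace ℝ β`. [folklore] -/
theorem exists_blockAverageCLM (blk : σ → β) :
    ∃ D : EuclideanSpace ℝ σ →L[ℝ] EuclideanSpace ℝ β,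
      ∀ (v : EuclideanSpace ℝ σ) (y : β),
        D v y = (∑ x ∈ univ.filter (fun x => blk x = y), v x) / #(univ.filter fun x => blk x = y) := by
  let A : (σ → ℝ) →ₗ[ℝ] (β → ℝ) :=
    { toFun := fun v y => (∑ x ∈ univ.filter (fun x => blk x = y), v x) / #(univ.filter fun x => blk x = y)
      map_add' := fun v w => by ext y; simp [sum_add_distrib, add_div]
      map_smul' := fun c v => by ext y; simp [← mul_sum, mul_div_assoc] }
  refine ⟨LinearMap.toContinuousLinearMap
    ((WithLp.linearEquiv 2 ℝ (β → ℝ)).symm.toLinearMap ∘ₗ A ∘ₗ (WithLp.linearEquiv 2 ℝ (σ → ℝ)).toLinearMap), fun v y => ?_⟩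
  simp [A]

omit [DecidableEq β] in
/-- THE BLOCK-CONSTANT SECTION EXISTS AS A CONTINUOUS LINEAR MAP `EuclideanSpace ℝ β →L EuclideanSpace ℝ σ`. [folklore] -/
theorem exists_blockConstantCLM (blk : σ → β) :
    ∃ S : EuclideanSpace ℝ β →L[ℝ] EuclideanSpace ℝ σ, ∀ (k : EuclideanSpace ℝ β) (x : σ), S k x = k (blk x) := by
  let A : (β → ℝ) →ₗ[ℝ] (σ → ℝ) :=
    { toFun := fun k x => k (blk x)
      map_add' := fun k k' => by ext x; simp
      map_smul' := fun c k => by ext x; simp }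
  refine ⟨LinearMap.toContinuousLinearMap
    ((WithLp.linearEquiv 2 ℝ (σ → ℝ)).symm.toLinearMap ∘ₗ A ∘ₗ (WithLp.linearEquiv 2 ℝ (β → ℝ)).toLinearMap), fun k x => ?_⟩
  simp [A]

/-! ## §2. The letters in norm currency (TSPB by name) -/

section Letters

variable (blk : σ → β) {D : EuclideanSpace ℝ σ →L[ℝ] EuclideanSpace ℝ β} {S : EuclideanSpace ℝ β →L[ℝ] EuclideanSpace ℝ σ}
  (hD : ∀ (v : EuclideanSpace ℝ σ) (y : β),
    D v y = (∑ x ∈ univ.filter (fun x => blk x = y), v x) / #(univ.filter fun x => blk x = y))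
  (hS : ∀ (k : EuclideanSpace ℝ β) (x : σ), S k x = k (blk x))

omit [Fintype β] in
include hD hS in
/-- `D (S k) = k`: the block-constant section is a right inverse of the block average (every fibre inhabited). [folklore] -/
theorem blockAverage_blockConstant (hfib : ∀ y, 0 < #(univ.filter fun x => blk x = y)) (k : EuclideanSpace ℝ β) : D (S k) = k := by
  ext y
  rw [hD]
  have hc : (#(univ.filter fun x => blk x = y) : ℝ) ≠ 0 := by exact_mod_cast (hfib y).ne'
  rw [div_eq_iff hc, sum_congr rfl fun x hx => by rw [hS, (mem_filter.1 hx).2], sum_const, nsmul_eq_mul, mul_comm]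

include hD in
/-- **TFC's `hd` BY VALUE: `‖D v‖ ≤ N_min^{−1∕2}·‖v‖`** (fibres of size `≥ N_min ≥ 1`; TSPB `blockAverage_normSq_le` in norm currency). [folklore] -/
theorem norm_blockAverage_le {Nmin : ℕ} (hNmin : 0 < Nmin) (hmin : ∀ y, Nmin ≤ #(univ.filter fun x => blk x = y))
    (v : EuclideanSpace ℝ σ) : ‖D v‖ ≤ Real.sqrt ((Nmin : ℝ)⁻¹) * ‖v‖ := by
  have h := blockAverage_normSq_le blk (fun x => v x) hNmin hmin
  have hsq : ‖D v‖ ^ 2 ≤ (Real.sqrt ((Nmin : ℝ)⁻¹) * ‖v‖) ^ 2 := by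
    rw [mul_pow, Real.sq_sqrt (by positivity), norm_sq_eq_sum_sq, norm_sq_eq_sum_sq]
    calc ∑ y, D v y ^ 2 = ∑ y, ((∑ x ∈ univ.filter (fun x => blk x = y), v x) / #(univ.filter fun x => blk x = y)) ^ 2 :=
          sum_congr rfl fun y _ => by rw [hD]
      _ ≤ (Nmin : ℝ)⁻¹ * ∑ x, v x ^ 2 := h
  exact (pow_le_pow_iff_left₀ (norm_nonneg _) (by positivity) two_ne_zero).1 hsq

include hS in
/-- **HSTT's `‖M₂‖ ≤ μ` BY VALUE: `‖S k‖ ≤ N_max^{1∕2}·‖k‖`** (fibres of size `≤ N_max`; TSPB `blockConstant_normSq_le` in norm currency). [folklore] -/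
theorem norm_blockConstant_le {Nmax : ℕ} (hmax : ∀ y, #(univ.filter fun x => blk x = y) ≤ Nmax) (k : EuclideanSpace ℝ β) :
    ‖S k‖ ≤ Real.sqrt Nmax * ‖k‖ := by
  have h := blockConstant_normSq_le blk (fun y => k y) hmax
  have hsq : ‖S k‖ ^ 2 ≤ (Real.sqrt Nmax * ‖k‖) ^ 2 := by
    rw [mul_pow, Real.sq_sqrt (Nat.cast_nonneg _), norm_sq_eq_sum_sq, norm_sq_eq_sum_sq]
    calc ∑ x, S k x ^ 2 = ∑ x, k (blk x) ^ 2 := sum_congr rfl fun x _ => by rw [hS]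
      _ ≤ (Nmax : ℝ) * ∑ y, k y ^ 2 := h
  exact (pow_le_pow_iff_left₀ (norm_nonneg _) (by positivity) two_ne_zero).1 hsq

include hS in
/-- EQUAL FIBRES: `‖S k‖² = N·‖k‖²` exactly, hence `‖S k‖ = N^{1∕2}‖k‖`. [folklore] -/
theorem norm_blockConstant_sq_eq {N : ℕ} (hfib : ∀ y, #(univ.filter fun x => blk x = y) = N) (k : EuclideanSpace ℝ β) :
    ‖S k‖ ^ 2 = (N : ℝ) * ‖k‖ ^ 2 := by
  rw [norm_sq_eq_sum_sq, norm_sq_eq_sum_sq, mul_sum]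
  calc ∑ x, S k x ^ 2 = ∑ x, k (blk x) ^ 2 := sum_congr rfl fun x _ => by rw [hS]
    _ = ∑ y, (#(univ.filter fun x => blk x = y) : ℝ) * k y ^ 2 := blockConstant_normSq_eq blk (fun y => k y)
    _ = ∑ y, (N : ℝ) * k y ^ 2 := sum_congr rfl fun y _ => by rw [hfib]

include hS in
/-- **PS-1 VALUED (`t4-ne7b-idea-1` g102, journal l.59923)**: with equal fibres `N = L^d` and the canonical `t² = L²∕L^d`,
`t²·‖S k‖² = L²·‖k‖²` — the embed-then-rescale map has norm EXACTLY `L` on every nonzero `k` in the `ℓ²` currency of the hard-step chain,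
so HSTB's `s = |t|K₁ < 1` with `K₁ > N₀ ≥ ‖M₂‖` cannot hold there. [folklore] -/
theorem embed_rescale_sq {L : ℝ} (hL : 0 < L) {d : ℕ} {N : ℕ} (hN : (N : ℝ) = L ^ d)
    (hfib : ∀ y, #(univ.filter fun x => blk x = y) = N) (k : EuclideanSpace ℝ β) :
    L ^ 2 / L ^ d * ‖S k‖ ^ 2 = L ^ 2 * ‖k‖ ^ 2 := by
  rw [norm_blockConstant_sq_eq blk hS hfib k, hN]
  have hLd : L ^ d ≠ 0 := pow_ne_zero d hL.ne'
  field_simp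

omit [Fintype γ] in
include hD in
/-- `D⁺ (D v) = 0 ↔` ZERO `L²`-BLOCK SUMS (equal fibres `N ≥ 1`; TSPB `ker_comp_iff_compositeBlockSums` BY NAME, `D⁺` the coarse block average by its
characterising hypothesis). [folklore] -/
theorem comp_eq_zero_iff_compositeBlockSums (blk₂ : β → γ) {Dn : EuclideanSpace ℝ β →L[ℝ] EuclideanSpace ℝ γ}
    (hDn : ∀ (k : EuclideanSpace ℝ β) (z : γ),
      Dn k z = (∑ y ∈ univ.filter (fun y => blk₂ y = z), k y) / #(univ.filter fun y => blk₂ y = z))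
    {N : ℕ} (hN : 0 < N) (hfib : ∀ y, #(univ.filter fun x => blk x = y) = N) (v : EuclideanSpace ℝ σ) :
    Dn (D v) = 0 ↔ ∀ z, ∑ x ∈ univ.filter (fun x => blk₂ (blk x) = z), v x = 0 := by
  rw [← ker_comp_iff_compositeBlockSums blk blk₂ (fun x => v x) hN hfib]
  constructor
  · intro h z
    have hz := congrArg (fun w : EuclideanSpace ℝ γ => w z) h
    simp only [PiLp.zero_apply] at hz
    rw [hDn] at hz
    have hN' : (#(univ.filter fun y => blk₂ y = z) : ℝ) ≠ 0 ∨ (#(univ.filter fun y => blk₂ y = z) : ℝ) = 0 := ne_or_eq _ _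
    rcases hN' with hne | heq
    · have hsum : ∑ y ∈ univ.filter (fun y => blk₂ y = z), D v y = 0 := by
        rcases (div_eq_zero_iff.1 hz) with h1 | h1
        · exact h1
        · exact absurd h1 hne
      rw [← hsum]
      exact sum_congr rfl fun y _ => by rw [hD]
    · -- an empty coarse fibre: the sum over it is empty
      have hempty : univ.filter (fun y => blk₂ y = z) = ∅ := by
        rw [← Finset.card_eq_zero]; exact_mod_cast heq
      rw [hempty, sum_empty]
  · intro h
    ext z
    rw [PiLp.zero_apply, hDn, div_eq_zero_iff]
    left
    rw [← h z]
    exact sum_congr rfl fun y _ => by rw [hD]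

end Letters

/-! ## §3. THE JUNCTION BY NAME: the next kernel coercivity from the two-scale Poincaré letter (TFC) -/

/-- **THE NEXT KERNEL COERCIVITY FROM THE LATTICE TWO-SCALE LETTER, TFC BY NAME.**  Equal fibres of size `N ≥ 1`; `D`, `S`, `D⁺` the block
average, the block-constant section and the coarse block average (characterising hypotheses); `Q : E →L E →L ℝ` any form with the two-scale
Poincaré letter on zero composite-block sums, `∀ v, (∀ z, Σ_{blk₂(blk x) = z} v x = 0) → m₂·‖v‖² ≤ Q v v` (`0 ≤ m₂`; TSPB ∕ CPT give
`m₂ = (L²(L² − 1))⁻¹` for the Dirichlet form).  Then every `k ∈ ker D⁺` has `(m₂·N)·‖k‖² ≤ (Q.bilinearComp S S) k k` —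
`…TransportedFormCoercivity.kerCoercive_bilinearComp_div` with `d := N^{−1∕2}` (`m₂∕d² = m₂·N`). [folklore] -/
theorem kerCoercive_next_of_twoScalePoincare (blk : σ → β) (blk₂ : β → γ)
    {D : EuclideanSpace ℝ σ →L[ℝ] EuclideanSpace ℝ β} {S : EuclideanSpace ℝ β →L[ℝ] EuclideanSpace ℝ σ}
    {Dn : EuclideanSpace ℝ β →L[ℝ] EuclideanSpace ℝ γ}
    (hD : ∀ (v : EuclideanSpace ℝ σ) (y : β),
      D v y = (∑ x ∈ univ.filter (fun x => blk x = y), v x) / #(univ.filter fun x => blk x = y))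
    (hS : ∀ (k : EuclideanSpace ℝ β) (x : σ), S k x = k (blk x))
    (hDn : ∀ (k : EuclideanSpace ℝ β) (z : γ),
      Dn k z = (∑ y ∈ univ.filter (fun y => blk₂ y = z), k y) / #(univ.filter fun y => blk₂ y = z))
    {N : ℕ} (hN : 0 < N) (hfib : ∀ y, #(univ.filter fun x => blk x = y) = N)
    {Q : EuclideanSpace ℝ σ →L[ℝ] EuclideanSpace ℝ σ →L[ℝ] ℝ} {m₂ : ℝ} (hm₂ : 0 ≤ m₂)
    (hQ : ∀ v : EuclideanSpace ℝ σ, (∀ z, ∑ x ∈ univ.filter (fun x => blk₂ (blk x) = z), v x = 0) → m₂ * ‖v‖ ^ 2 ≤ Q v v) :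
    ∀ k, Dn k = 0 → m₂ * N * ‖k‖ ^ 2 ≤ Q.bilinearComp S S k k := by
  have hNr : (0 : ℝ) < N := by exact_mod_cast hN
  -- TFC's letters: right inverse, two-scale coercivity on `ker (D⁺ ∘ D)`, the size of `D`
  have hSec : ∀ k, D (S k) = k :=
    blockAverage_blockConstant blk hD hS (fun y => by rw [hfib]; exact hN)
  have hco : ∀ v, Dn (D v) = 0 → m₂ * ‖v‖ ^ 2 ≤ Q v v := fun v hv =>
    hQ v ((comp_eq_zero_iff_compositeBlockSums blk hD blk₂ hDn hN hfib v).1 hv)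
  have hd : ∀ v, ‖D v‖ ≤ Real.sqrt ((N : ℝ)⁻¹) * ‖v‖ :=
    norm_blockAverage_le blk hD hN (fun y => (hfib y).ge)
  have hd0 : 0 < Real.sqrt ((N : ℝ)⁻¹) := Real.sqrt_pos.2 (inv_pos.2 hNr)
  intro k hk
  have h := kerCoercive_bilinearComp_div hSec Dn hm₂ hco hd0 hd k hk
  have hsq : Real.sqrt ((N : ℝ)⁻¹) ^ 2 = (N : ℝ)⁻¹ := Real.sq_sqrt (inv_nonneg.2 hNr.le)
  rw [hsq, div_inv_eq_mul] at h
  exact h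

/-! ## §4. Toy -/

/-- Toy: two fibres of two sites (`Fin 4 → Fin 2`, `x ↦ x ∕ 2`); the block average CLM exists and averages. -/
example : ∃ D : EuclideanSpace ℝ (Fin 4) →L[ℝ] EuclideanSpace ℝ (Fin 2),
    ∀ (v : EuclideanSpace ℝ (Fin 4)) (y : Fin 2),
      D v y = (∑ x ∈ univ.filter (fun x : Fin 4 => (⟨x.val / 2, by omega⟩ : Fin 2) = y), v x) /
        #(univ.filter fun x : Fin 4 => (⟨x.val / 2, by omega⟩ : Fin 2) = y) :=
  exists_blockAverageCLM _

end Summit.QuantumFields.BalabanUV.T4Continuum.NE7b.TwoScalePoincareTransported
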